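import Literature.NumberTheory.LFunctions.LFDSingleDetectAvg
import HarnessLib

/-!
# Log-free zero density for one character, VII: finite Gram entries and the factorisation

Topic `Literature/NumberTheory/LFunctions`, sub-namespace `LFDSingle`. Everything here is PROVED.
The duality step works with the finite sums over `1 ≤ n ≤ N₁` with the averaged weights `w̃_n`
of part VI. Writing `r_n = (w̃_n/n)^{1/2}` and

  `a_n(ρ) = (θ∗1)(n) χ(n) n^{1−ρ} r_n`,   `b_n = (ψ∗1)(n) r_n`,

one has `a_n(ρ) b_n = c(n)χ(n)n^{-ρ} w̃_n` (the detector summand, `aCoef_mul_bCoef`) and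
`a_n(ρ) \overline{a_n(ρ')} = (θ∗1)(n)² χ₀(n) n^{-κ} w̃_n`, `κ = ρ + ρ̄' − 1` (the Gram summand,
`aCoef_mul_conj_aCoef`). The finite Gram entry `G_fin(κ) = Σ_{n ≤ N₁} (θ∗1)² χ₀ n^{-κ} w̃_n`
differs from the averaged Gram sum of part IV by exponentially small tails
(`norm_gramFin_sub_gramAvg_le`), whence (`norm_gramFin_le`)

  `‖G_fin(κ)‖ ≤ (φ(q)/q) ‖D_q(1)‖ g(1 − κ) + 512 K₂ R^{1/2} Y^{-1/4} + 2⌊W⌋²(1 + X) e^{-N₁/X}`.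

## References
* D. R. Heath-Brown, PLMS 64 (1992), §11 (11.11)–(11.17). [cite: HeathBrown1992PLMS, §11]
-/

noncomputable section

open Finset Real Complex
open Literature.NumberTheory.Sieve Literature.NumberTheory.Sieve.GrahamWeights

namespace Literature.NumberTheory.LFunctions.LFDSingle

variable {q : ℕ}

/-! ### The finite Gram entries and their tails -/

/-- `G_fin(κ) = Σ_{1 ≤ n ≤ N₁} (θ∗1)(n)² χ₀(n) n^{-κ} w̃_n`. [cite: HeathBrown1992PLMS, §11 (11.15)] -/
def gramFin (W X Y R : ℝ) (J N₁ : ℕ) (κ : ℂ) : ℂ :=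
  ∑ n ∈ Icc 1 N₁, bcoef (1 : DirichletCharacter ℂ q) 1 W W κ n * (wAvg X Y R J n : ℂ)

/-- **The tails**: `‖G_fin(κ) − G̃(κ)‖ ≤ 2⌊W⌋²(1 + X)e^{-N₁/X}` (`re κ ≥ 0`, `1 < W`, `R ≥ 1`,
`R² ≤ Y ≤ X`, `J ≥ 1`). [folklore] -/
theorem norm_gramFin_sub_gramAvg_le {W X Y R : ℝ} {J : ℕ} (hW : 1 < W) (hR : 1 ≤ R) (hY : R ^ 2 ≤ Y)
    (hYX : Y ≤ X) (hJ : 0 < J) (N₁ : ℕ) {κ : ℂ} (hκ : 0 ≤ κ.re) :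
    ‖gramFin (q := q) W X Y R J N₁ κ - gramAvg (q := q) W X Y R J κ‖ ≤
      2 * ((⌊W⌋₊ : ℝ) * ⌊W⌋₊ * ((1 + X) * Real.exp (-(N₁ : ℝ) / X))) := by
  have hR0 : 0 < R := by linarith
  have hR2 : 1 ≤ R ^ 2 := one_le_pow₀ hR
  have hY1 : 1 ≤ Y := hR2.trans hY
  have hY0 : 0 < Y := by linarith
  have hX0 : 0 < X := by linarith
  have hJ' : (J : ℂ) ≠ 0 := by exact_mod_cast hJ.ne'
  have hWW : 0 ≤ (⌊W⌋₊ : ℝ) * ⌊W⌋₊ := by positivity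
  set χ₀ : DirichletCharacter ℂ q := 1
  set t : ℕ → ℕ → ℝ := fun j j' => scaleExp j j' J with ht
  have hscale : ∀ j ∈ range J, ∀ j' ∈ range J,
      0 < X * R ^ (-t j j') ∧ X * R ^ (-t j j') ≤ X ∧ 0 < Y * R ^ (-t j j') ∧ Y * R ^ (-t j j') ≤ X := by
    intro j hj j' hj'
    have hpos : 0 < R ^ (-t j j') := Real.rpow_pos_of_pos hR0 _
    have hhi : R ^ (-t j j') ≤ 1 :=
      Real.rpow_le_one_of_one_le_of_nonpos hR (by simp only [ht]; linarith [scaleExp_nonneg j j' J])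
    refine ⟨mul_pos hX0 hpos, ?_, mul_pos hY0 hpos, ?_⟩
    · calc X * R ^ (-t j j') ≤ X * 1 := mul_le_mul_of_nonneg_left hhi hX0.le
        _ = X := mul_one X
    · calc Y * R ^ (-t j j') ≤ X * R ^ (-t j j') := mul_le_mul_of_nonneg_right hYX hpos.le
        _ ≤ X * 1 := mul_le_mul_of_nonneg_left hhi hX0.le
        _ = X := mul_one X
  set B : ℝ := 2 * ((⌊W⌋₊ : ℝ) * ⌊W⌋₊ * ((1 + X) * Real.exp (-(N₁ : ℝ) / X))) with hB
  -- per scale: finite sum = gramSum + (T₂ - T₁)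
  have hper : ∀ j ∈ range J, ∀ j' ∈ range J, ∃ T : ℂ, ‖T‖ ≤ B ∧
      ∑ n ∈ Icc 1 N₁, bcoef χ₀ 1 W W κ n *
        ((Real.exp (-(n / (X * R ^ (-t j j')))) - Real.exp (-(n / (Y * R ^ (-t j j')))) : ℝ) : ℂ) =
        gramSum (q := q) W (X * R ^ (-t j j')) (Y * R ^ (-t j j')) κ + T := by
    intro j hj j' hj'
    obtain ⟨hX'0, hX'X, hY'0, hY'X⟩ := hscale j hj j' hj'
    set X' := X * R ^ (-t j j') with hX'
    set Y' := Y * R ^ (-t j j') with hY'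
    obtain ⟨T₁, hT₁, h1⟩ := tsum_detTerm_eq_sum_add χ₀ le_rfl hW hW hκ hX'0 N₁
    obtain ⟨T₂, hT₂, h2⟩ := tsum_detTerm_eq_sum_add χ₀ le_rfl hW hW hκ hY'0 N₁
    refine ⟨T₂ - T₁, ?_, ?_⟩
    · have h1' : ‖T₁‖ ≤ (⌊W⌋₊ : ℝ) * ⌊W⌋₊ * ((1 + X) * Real.exp (-(N₁ : ℝ) / X)) :=
        hT₁.trans (mul_le_mul_of_nonneg_left (tail_mono hX'0 hX'X (Nat.cast_nonneg _)) hWW)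
      have h2' : ‖T₂‖ ≤ (⌊W⌋₊ : ℝ) * ⌊W⌋₊ * ((1 + X) * Real.exp (-(N₁ : ℝ) / X)) :=
        hT₂.trans (mul_le_mul_of_nonneg_left (tail_mono hY'0 hY'X (Nat.cast_nonneg _)) hWW)
      calc ‖T₂ - T₁‖ ≤ ‖T₂‖ + ‖T₁‖ := norm_sub_le _ _
        _ ≤ B := by rw [hB]; linarith
    · have hsplit : ∑ n ∈ Icc 1 N₁, bcoef χ₀ 1 W W κ n *
          ((Real.exp (-(n / X')) - Real.exp (-(n / Y')) : ℝ) : ℂ) =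
          ∑ n ∈ Icc 1 N₁, bcoef χ₀ 1 W W κ n * (Real.exp (-(n * X'⁻¹)) : ℂ) -
            ∑ n ∈ Icc 1 N₁, bcoef χ₀ 1 W W κ n * (Real.exp (-(n * Y'⁻¹)) : ℂ) := by
        rw [← sum_sub_distrib]
        refine sum_congr rfl fun n _ => ?_
        rw [show (n / X' : ℝ) = n * X'⁻¹ by ring, show (n / Y' : ℝ) = n * Y'⁻¹ by ring]
        push_cast; ring
      have hG : gramSum (q := q) W X' Y' κ =
          ∑' n : ℕ, detTerm χ₀ 1 W W κ X' n - ∑' n : ℕ, detTerm χ₀ 1 W W κ Y' n := rfl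
      rw [hsplit, hG, h1, h2]; ring
  -- expand `gramFin` as the average of the per-scale finite sums
  have hexp : gramFin (q := q) W X Y R J N₁ κ = ((J : ℂ) ^ 2)⁻¹ * ∑ j ∈ range J, ∑ j' ∈ range J,
      ∑ n ∈ Icc 1 N₁, bcoef χ₀ 1 W W κ n *
        ((Real.exp (-(n / (X * R ^ (-t j j')))) - Real.exp (-(n / (Y * R ^ (-t j j')))) : ℝ) : ℂ) := by
    rw [gramFin]
    simp only [wAvg, ht]
    push_cast
    set c : ℂ := ((J : ℂ) ^ 2)⁻¹ with hc
    calc ∑ n ∈ Icc 1 N₁, bcoef χ₀ 1 W W κ n * (c * ∑ j ∈ range J, ∑ j' ∈ range J,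
          (Complex.exp (-((n : ℂ) / ((X : ℂ) * ((R ^ (-scaleExp j j' J) : ℝ) : ℂ)))) -
            Complex.exp (-((n : ℂ) / ((Y : ℂ) * ((R ^ (-scaleExp j j' J) : ℝ) : ℂ))))))
        = ∑ n ∈ Icc 1 N₁, ∑ j ∈ range J, ∑ j' ∈ range J, c * (bcoef χ₀ 1 W W κ n *
          (Complex.exp (-((n : ℂ) / ((X : ℂ) * ((R ^ (-scaleExp j j' J) : ℝ) : ℂ)))) -
            Complex.exp (-((n : ℂ) / ((Y : ℂ) * ((R ^ (-scaleExp j j' J) : ℝ) : ℂ)))))) := by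
          refine sum_congr rfl fun n _ => ?_
          rw [mul_left_comm, mul_sum]
          simp_rw [mul_sum]
      _ = ∑ j ∈ range J, ∑ n ∈ Icc 1 N₁, ∑ j' ∈ range J, c * (bcoef χ₀ 1 W W κ n *
          (Complex.exp (-((n : ℂ) / ((X : ℂ) * ((R ^ (-scaleExp j j' J) : ℝ) : ℂ)))) -
            Complex.exp (-((n : ℂ) / ((Y : ℂ) * ((R ^ (-scaleExp j j' J) : ℝ) : ℂ)))))) := sum_comm
      _ = ∑ j ∈ range J, ∑ j' ∈ range J, ∑ n ∈ Icc 1 N₁, c * (bcoef χ₀ 1 W W κ n *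
          (Complex.exp (-((n : ℂ) / ((X : ℂ) * ((R ^ (-scaleExp j j' J) : ℝ) : ℂ)))) -
            Complex.exp (-((n : ℂ) / ((Y : ℂ) * ((R ^ (-scaleExp j j' J) : ℝ) : ℂ)))))) :=
          sum_congr rfl fun j _ => sum_comm
      _ = ∑ j ∈ range J, c * ∑ j' ∈ range J, ∑ n ∈ Icc 1 N₁, (bcoef χ₀ 1 W W κ n *
          (Complex.exp (-((n : ℂ) / ((X : ℂ) * ((R ^ (-scaleExp j j' J) : ℝ) : ℂ)))) -
            Complex.exp (-((n : ℂ) / ((Y : ℂ) * ((R ^ (-scaleExp j j' J) : ℝ) : ℂ)))))) := by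
          refine sum_congr rfl fun j _ => ?_
          rw [mul_sum]
          refine sum_congr rfl fun j' _ => ?_
          rw [mul_sum]
      _ = _ := by rw [← mul_sum]
  -- choose the tails and subtract
  classical
  choose! T hT using hper
  have hdiff : gramFin (q := q) W X Y R J N₁ κ - gramAvg (q := q) W X Y R J κ =
      ((J : ℂ) ^ 2)⁻¹ * ∑ j ∈ range J, ∑ j' ∈ range J, T j j' := by
    rw [hexp, gramAvg, ← mul_sub, ← sum_sub_distrib]
    congr 1
    refine sum_congr rfl fun j hj => ?_
    rw [← sum_sub_distrib]
    refine sum_congr rfl fun j' hj' => ?_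
    have h := (hT j hj j' hj').2
    simp only [ht] at h
    rw [h]
    ring
  rw [hdiff, norm_mul, norm_inv, norm_pow, Complex.norm_natCast]
  have hJ2 : (0 : ℝ) < (J : ℝ) ^ 2 := by positivity
  calc ((J : ℝ) ^ 2)⁻¹ * ‖∑ j ∈ range J, ∑ j' ∈ range J, T j j'‖
      ≤ ((J : ℝ) ^ 2)⁻¹ * ∑ j ∈ range J, ∑ j' ∈ range J, B := by
        refine mul_le_mul_of_nonneg_left ?_ (by positivity)
        exact (norm_sum_le _ _).trans (sum_le_sum fun j hj => (norm_sum_le _ _).trans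
          (sum_le_sum fun j' hj' => (hT j hj j' hj').1))
    _ = B := by rw [sum_const, sum_const, card_range, nsmul_eq_mul, nsmul_eq_mul]; field_simp

/-- **The finite Gram entries.** For `q ≥ 1`, `1 < W`, `R ≥ 1`, `R² ≤ Y ≤ X`, `J ≥ 1` and
`1/2 ≤ re κ < 1`:
`‖G_fin(κ)‖ ≤ (φ(q)/q)‖D_q(1)‖ g(1 − κ) + 512 K₂ R^{1/2} Y^{-1/4} + 2⌊W⌋²(1 + X)e^{-N₁/X}`.
[cite: HeathBrown1992PLMS, §11 (11.15)–(11.17)] -/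
theorem norm_gramFin_le [NeZero q] (hq : q ≠ 0) {W X Y R : ℝ} {J : ℕ} (hW : 1 < W) (hR : 1 ≤ R)
    (hY : R ^ 2 ≤ Y) (hYX : Y ≤ X) (hJ : 0 < J) (N₁ : ℕ) {κ : ℂ} (hκ : 1 / 2 ≤ κ.re) (hκ1 : κ.re < 1) :
    ‖gramFin (q := q) W X Y R J N₁ κ‖ ≤
      (q.totient : ℝ) / q * ‖Fpoly (1 : DirichletCharacter ℂ q) 1 W W 1‖ * kernel X Y R J (1 - κ) +
        512 * (4096 * π ^ 2 / 3 * 2 ^ q.primeFactors.card * (1 + ‖κ‖) * ((⌊W⌋₊ : ℝ) * ⌊W⌋₊) *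
          (R ^ (1 / 2 : ℝ) * Y ^ (-(1 / 4 : ℝ)))) +
        2 * ((⌊W⌋₊ : ℝ) * ⌊W⌋₊ * ((1 + X) * Real.exp (-(N₁ : ℝ) / X))) := by
  have h1 := norm_gramFin_sub_gramAvg_le (q := q) hW hR hY hYX hJ N₁ (by linarith : 0 ≤ κ.re)
  have h2 := norm_gramAvg_le hq hW hR hY hYX hJ hκ hκ1
  have h3 : ‖gramFin (q := q) W X Y R J N₁ κ‖ ≤ ‖gramAvg (q := q) W X Y R J κ‖ +
      ‖gramFin (q := q) W X Y R J N₁ κ - gramAvg (q := q) W X Y R J κ‖ := by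
    have := norm_add_le (gramAvg (q := q) W X Y R J κ) (gramFin (q := q) W X Y R J N₁ κ - gramAvg (q := q) W X Y R J κ)
    rwa [add_sub_cancel] at this
  rw [kernel, ← mul_assoc]
  linarith


/-! ### The factorisation `c(n)χ(n)n^{-ρ} w̃_n = a_n(ρ) b_n` -/

variable (χ : DirichletCharacter ℂ q) {U V W X Y R : ℝ} {J : ℕ}

/-- `r_n = (w̃_n / n)^{1/2}`. [folklore] -/
def rW (X Y R : ℝ) (J : ℕ) (n : ℕ) : ℝ := Real.sqrt (wAvg X Y R J n / n)

/-- `a_n(ρ) = (θ∗1)(n) χ(n) n^{1−ρ} r_n`. [cite: HeathBrown1992PLMS, §11 (11.11)] -/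
def aCoef (W X Y R : ℝ) (J : ℕ) (ρ : ℂ) (n : ℕ) : ℂ :=
  (psiStar 1 W n : ℂ) * χ n * (n : ℂ) ^ (1 - ρ) * (rW X Y R J n : ℂ)

/-- `b_n = (ψ∗1)(n) r_n` (real). [cite: HeathBrown1992PLMS, §11 (11.12)] -/
def bCoef (U V X Y R : ℝ) (J : ℕ) (n : ℕ) : ℝ := psiStar U V n * rW X Y R J n

/-- `r_n² = w̃_n / n` (`w̃_n ≥ 0`). [folklore] -/
theorem rW_sq (hY : 0 < Y) (hYX : Y ≤ X) (hR : 1 ≤ R) (hJ : 0 < J) (n : ℕ) :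
    rW X Y R J n ^ 2 = wAvg X Y R J n / n := by
  rw [rW, Real.sq_sqrt (div_nonneg (wAvg_mem hY hYX hR hJ n).1 (Nat.cast_nonneg n))]

/-- `a_n(ρ) b_n = b(n) w̃_n = c(n)χ(n)n^{-ρ} w̃_n` (`n ≥ 1`). [folklore] -/
theorem aCoef_mul_bCoef (hY : 0 < Y) (hYX : Y ≤ X) (hR : 1 ≤ R) (hJ : 0 < J) (ρ : ℂ) {n : ℕ}
    (hn : 1 ≤ n) :
    aCoef χ W X Y R J ρ n * (bCoef U V X Y R J n : ℂ) = bcoef χ U V W ρ n * (wAvg X Y R J n : ℂ) := by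
  have hn0 : (n : ℂ) ≠ 0 := by exact_mod_cast (show n ≠ 0 by omega)
  have hn0' : (n : ℝ) ≠ 0 := by exact_mod_cast (show n ≠ 0 by omega)
  have hr2 : ((rW X Y R J n : ℂ)) ^ 2 = (wAvg X Y R J n : ℂ) / n := by
    rw [← Complex.ofReal_pow, rW_sq hY hYX hR hJ n]; push_cast; ring
  have hcpow : (n : ℂ) ^ (1 - ρ) = (n : ℂ) * (n : ℂ) ^ (-ρ) := by
    rw [show (1 - ρ : ℂ) = 1 + -ρ by ring, Complex.cpow_add _ _ hn0, Complex.cpow_one]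
  rw [aCoef, bCoef, bcoef, coef]
  push_cast
  rw [hcpow]
  have : (psiStar 1 W n : ℂ) * χ n * ((n : ℂ) * (n : ℂ) ^ (-ρ)) * (rW X Y R J n : ℂ) *
      ((psiStar U V n : ℂ) * (rW X Y R J n : ℂ)) =
      (psiStar U V n : ℂ) * (psiStar 1 W n : ℂ) * χ n * (n : ℂ) ^ (-ρ) * ((n : ℂ) * (rW X Y R J n : ℂ) ^ 2) := by
    ring
  rw [this, hr2]
  field_simp

/-- `conj (n^s) = n^{conj s}` for a natural number `n`. [folklore] -/
theorem conj_natCast_cpow (n : ℕ) (s : ℂ) : (starRingEnd ℂ) ((n : ℂ) ^ s) = (n : ℂ) ^ ((starRingEnd ℂ) s) := by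
  have h := Complex.conj_cpow (n : ℂ) ((starRingEnd ℂ) s) (by rw [Complex.natCast_arg]; exact Real.pi_ne_zero.symm)
  rw [Complex.conj_conj, Complex.conj_natCast] at h
  exact h.symm

/-- `χ(n) \overline{χ(n)} = χ₀(n)`. [folklore] -/
theorem mul_conj_apply (n : ℕ) : χ n * (starRingEnd ℂ) (χ n) = (1 : DirichletCharacter ℂ q) (n : ZMod q) := by
  by_cases h : IsUnit (n : ZMod q)
  · obtain ⟨u, hu⟩ := h
    rw [← hu, MulChar.one_apply_coe, Complex.mul_conj, Complex.normSq_eq_norm_sq,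
      DirichletCharacter.unit_norm_eq_one χ u]
    simp
  · rw [MulChar.map_nonunit χ h, MulChar.map_nonunit _ h, zero_mul]

/-- `a_n(ρ) \overline{a_n(ρ')} = (θ∗1)(n)² χ₀(n) n^{-κ} w̃_n`, `κ = ρ + ρ̄' − 1` (`n ≥ 1`). [folklore] -/
theorem aCoef_mul_conj_aCoef (hY : 0 < Y) (hYX : Y ≤ X) (hR : 1 ≤ R) (hJ : 0 < J) (ρ ρ' : ℂ) {n : ℕ}
    (hn : 1 ≤ n) :
    aCoef χ W X Y R J ρ n * (starRingEnd ℂ) (aCoef χ W X Y R J ρ' n) =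
      bcoef (1 : DirichletCharacter ℂ q) 1 W W (ρ + (starRingEnd ℂ) ρ' - 1) n * (wAvg X Y R J n : ℂ) := by
  have hn0 : (n : ℂ) ≠ 0 := by exact_mod_cast (show n ≠ 0 by omega)
  have hr2 : ((rW X Y R J n : ℂ)) ^ 2 = (wAvg X Y R J n : ℂ) / n := by
    rw [← Complex.ofReal_pow, rW_sq hY hYX hR hJ n]; push_cast; ring
  -- conjugate of `a_n(ρ')`
  have hconj : (starRingEnd ℂ) (aCoef χ W X Y R J ρ' n) =
      (psiStar 1 W n : ℂ) * (starRingEnd ℂ) (χ n) * (n : ℂ) ^ (1 - (starRingEnd ℂ) ρ') * (rW X Y R J n : ℂ) := by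
    rw [aCoef, map_mul, map_mul, map_mul, Complex.conj_ofReal, Complex.conj_ofReal, conj_natCast_cpow,
      map_sub, map_one]
  -- the powers of `n`
  have hcpow : (n : ℂ) ^ (1 - ρ) * (n : ℂ) ^ (1 - (starRingEnd ℂ) ρ') =
      (n : ℂ) * (n : ℂ) ^ (-(ρ + (starRingEnd ℂ) ρ' - 1)) := by
    rw [← Complex.cpow_add _ _ hn0, show (1 - ρ + (1 - (starRingEnd ℂ) ρ') : ℂ) = 1 + -(ρ + (starRingEnd ℂ) ρ' - 1) by ring,
      Complex.cpow_add _ _ hn0, Complex.cpow_one]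
  rw [hconj, aCoef, bcoef, coef]
  push_cast
  have : (psiStar 1 W n : ℂ) * χ n * (n : ℂ) ^ (1 - ρ) * (rW X Y R J n : ℂ) *
      ((psiStar 1 W n : ℂ) * (starRingEnd ℂ) (χ n) * (n : ℂ) ^ (1 - (starRingEnd ℂ) ρ') * (rW X Y R J n : ℂ)) =
      (psiStar 1 W n : ℂ) * (psiStar 1 W n : ℂ) * (χ n * (starRingEnd ℂ) (χ n)) *
        ((n : ℂ) ^ (1 - ρ) * (n : ℂ) ^ (1 - (starRingEnd ℂ) ρ')) * (rW X Y R J n : ℂ) ^ 2 := by ring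
  rw [this, mul_conj_apply, hcpow, hr2]
  field_simp

end Literature.NumberTheory.LFunctions.LFDSingle
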